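import Literature.NumberTheory.EllipticCurves.ZpExtensionEisensteinTwistDualityForm
import HarnessLib

/-!
# The duality form of the Eisenstein levels restricted to twisted plus parts `A_{m,k} ⊗ Fil`: orthogonality, exact
# right orthogonal and representability lift from `M` to `M ⊗ A_{m,k}` (theorems only; no definition, no named fact,
# no instance, no `sorry`)

Topic `NumberTheory/EllipticCurves` (sequel to `ZpExtensionEisensteinTwistDualityForm` (the `A_{m,k}`-bilinear form
`eisensteinDualityForm hm k eb (c₁ ⊗ a₁, c₂ ⊗ a₂) = c₁ c₂ ι(eb(a₁, a₂))`, Howard's `e_𝔮` at a finite level) and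
`ZpExtensionEisensteinTwistDualPerfect` (tail-form dual family `[πⱼ^*]`, coordinates); cell `pub/bsd-print-x9`, brick (B3) of
`HOME/p1/H4-EXACT-AT-P-PLAN`: Howard's H.4 at `v ∣ p` for the saturated `F_𝔮`).

Howard [Compositio Math. 140 (2004), Lemma 2.1.1 and Lemma 3.1.1, arXiv:1202.6340 p. 15 L60–62]: «`Fil_v(T_𝔭) ⊂ T_𝔭` is its
own exact orthogonal complement under `e_𝔭`», because `e_𝔭(t₁ ⊗ α₁, t₂ ⊗ α₂) = e(t₁, t₂^τ) α₁ α₂` and `Fil_v T` is its own exact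
orthogonal complement under the Weil pairing (twisted by `τ`).  At the finite level `W_k = M ⊗ A_{m,k}` (`M = E[p^k]`) the plus
parts are the spans `A_{m,k} ⊗ Fil = span {c ⊗ a | a ∈ Fil}` (`OrdinaryFiltration.twistedFil`).  This file lifts the three
`E`-LEVEL properties of a pair of subgroups `Fil₁, Fil₂ ≤ M` under `eb : M × M → ℤ/p^k` to the spans under the form
`E = eisensteinDualityForm hm k eb` read through the tail form `λ_k = tailFormZMod`:

* §1 `eisensteinDualityForm_eq_zero_of_mem_span_tmul` — `eb(Fil₁, Fil₂) = 0 ⇒ E(A ⊗ Fil₁, A ⊗ Fil₂) = 0` (the input `horth`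
  of `DualityDatum.exists_restrictedPairing`);
* §2 `exists_eq_sum_tmul_dualFamily_of_mem_span_tmul` — coordinates `s = ∑ⱼ [πⱼ^*] ⊗ uⱼ`, `uⱼ ∈ Fil`, of the elements of
  `A ⊗ Fil`; `sum_tmul_mem_span_tmul`;
* §3 **`mem_span_tmul_of_forall_tailFormZMod_eisensteinDualityForm_eq_zero`** — if the right `eb`-orthogonal of `Fil₁` is
  contained in `Fil₂`, the right `λ_k ∘ E`-orthogonal of `A ⊗ Fil₁` is contained in `A ⊗ Fil₂` (the input (hR) of
  `DualityDatum.restrictedPairing_cupProduct_nondegenerate`);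
* §4 **`exists_forall_tailFormZMod_eisensteinDualityForm_eq_of_mem_span_tmul`** — if every additive `φ` on `Fil₁` is
  `eb(·, b)` for some `b ∈ M`, every additive `Φ` on `A ⊗ Fil₁` is `λ_k E(·, t)` for some `t ∈ M ⊗ A_{m,k}` (the input (hS)).

Pure algebra of `A_{m,k} = Λ/(T^m + p, p^k)` (no Galois action, no curve); the `E`-instance (`Fil₁ = Fil_v E[p^k]`,
`Fil₂ = δ_v · Fil_v̄ E[p^k]`, `eb = conjPairing e τ_* log`) is the next file.  No summit statement is proved; BSD is not proved by
any of this.  Seat `bsd-line-x10b-p1-w7` g2.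

References: [Howard2004HeegnerKolyvagin] Lemma 2.1.1, §1.3 H.4, Lemma 3.1.1 (arXiv:1202.6340 p. 7 L69–82, p. 15 L56–62);
[DeSmitRubinSchoof1997] Cor. 2.2 (dual basis of a monogenic algebra); [Washington1997] §13.2.
-/

noncomputable section

open scoped TensorProduct



namespace Literature.NumberTheory.EllipticCurves

namespace ZpExtension

open IwasawaAlgebra

variable {p : ℕ} [hp : Fact p.Prime] {m : ℕ} (hm : 1 ≤ m) (k : ℕ) {M : Type} [AddCommGroup M]
  (eb : M →+ M →+ ZMod (p ^ k)) (Fil Fil₁ Fil₂ : Submodule ℤ M)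

/-! ## §1 Orthogonality of the twisted spans -/

/-- **`eb(Fil₁, Fil₂) = 0` implies `E(A ⊗ Fil₁, A ⊗ Fil₂) = 0`** for the duality form `E = eisensteinDualityForm hm k eb` and the
twisted plus parts `span {c ⊗ a | a ∈ Filᵢ}` (pure tensors: `E(c₁ ⊗ a₁, c₂ ⊗ a₂) = c₁ c₂ ι(eb(a₁, a₂))`).
[cite: Howard2004HeegnerKolyvagin, Lemma 2.1.1 and Lemma 3.1.1 (arXiv p. 15, L60–62)] -/
theorem eisensteinDualityForm_eq_zero_of_mem_span_tmul (horth : ∀ a ∈ Fil₁, ∀ b ∈ Fil₂, eb a b = 0)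
    {s : EisensteinCoeff.Twisted p m k M}
    (hs : s ∈ Submodule.span ℤ {x | ∃ (c : EisensteinCoeff p m k) (a : M), a ∈ Fil₁ ∧ x = EisensteinCoeff.Twisted.tmul c a})
    {t : EisensteinCoeff.Twisted p m k M}
    (ht : t ∈ Submodule.span ℤ {x | ∃ (c : EisensteinCoeff p m k) (a : M), a ∈ Fil₂ ∧ x = EisensteinCoeff.Twisted.tmul c a}) :
    eisensteinDualityForm hm k eb s t = 0 := by
  have hgen : ∀ (d : EisensteinCoeff p m k) (b : M), b ∈ Fil₂ →
      eisensteinDualityForm hm k eb s (EisensteinCoeff.Twisted.tmul d b) = 0 := by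
    intro d b hb
    induction hs using Submodule.span_induction with
    | mem x hx =>
      obtain ⟨c, a, ha, rfl⟩ := hx
      rw [scalarForm_tmul_tmul, horth a ha b hb, map_zero, mul_zero]
    | zero => rw [map_zero, LinearMap.zero_apply]
    | add x y _ _ hx hy => rw [map_add, LinearMap.add_apply, hx, hy, add_zero]
    | smul n x _ hx =>
      rw [← LinearMap.flip_apply (eisensteinDualityForm hm k eb), map_zsmul, LinearMap.flip_apply, hx, zsmul_zero]
  induction ht using Submodule.span_induction with
  | mem x hx =>
    obtain ⟨d, b, hb, rfl⟩ := hx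
    exact hgen d b hb
  | zero => rw [map_zero]
  | add x y _ _ hx hy => rw [map_add, hx, hy, add_zero]
  | smul n x _ hx => rw [map_zsmul, hx, zsmul_zero]

/-! ## §2 Coordinates of the twisted span with respect to the dual family -/

/-- A sum `∑ⱼ cⱼ ⊗ uⱼ` with all `uⱼ ∈ Fil` lies in the twisted span `span {c ⊗ a | a ∈ Fil}`.
[cite: Howard2004HeegnerKolyvagin, §2.2 (T_𝔮 = 𝐓 ⊗_Λ S_𝔮) and §3.1 (Fil_v T_𝔮 = Fil_v T ⊗ S_𝔮)] -/
theorem sum_tmul_mem_span_tmul (c : Fin m → EisensteinCoeff p m k) {u : Fin m → M} (hu : ∀ j, u j ∈ Fil) :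
    (∑ j : Fin m, EisensteinCoeff.Twisted.tmul (c j) (u j) : EisensteinCoeff.Twisted p m k M) ∈
      Submodule.span ℤ {x | ∃ (c : EisensteinCoeff p m k) (a : M), a ∈ Fil ∧ x = EisensteinCoeff.Twisted.tmul c a} :=
  Submodule.sum_mem _ fun j _ ↦ Submodule.subset_span ⟨c j, u j, hu j, rfl⟩

/-- **Dual-family coordinates of the twisted span**: every `s ∈ span {c ⊗ a | a ∈ Fil}` is `∑ⱼ [πⱼ^*] ⊗ uⱼ` with all
`uⱼ ∈ Fil` (`c = ∑ⱼ nⱼ [πⱼ^*]` with `nⱼ ∈ ℕ`, `exists_eq_sum_nsmul_dualFamily`, and `(n c) ⊗ a = c ⊗ (n a)`).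
[cite: DeSmitRubinSchoof1997, Cor. 2.2 (case n = 1)] [cite: Howard2004HeegnerKolyvagin, §2.2 and §3.1] -/
theorem exists_eq_sum_tmul_dualFamily_of_mem_span_tmul {s : EisensteinCoeff.Twisted p m k M}
    (hs : s ∈ Submodule.span ℤ {x | ∃ (c : EisensteinCoeff p m k) (a : M), a ∈ Fil ∧ x = EisensteinCoeff.Twisted.tmul c a}) :
    ∃ u : Fin m → M, (∀ j, u j ∈ Fil) ∧
      s = ∑ j : Fin m, EisensteinCoeff.Twisted.tmul (EisensteinCoeff.dualFamily p hm k j) (u j) := by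
  induction hs using Submodule.span_induction with
  | mem x hx =>
    obtain ⟨c, a, ha, rfl⟩ := hx
    obtain ⟨nn, rfl⟩ := EisensteinCoeff.exists_eq_sum_nsmul_dualFamily p hm k c
    refine ⟨fun j ↦ nn j • a, fun j ↦ Submodule.smul_of_tower_mem _ (nn j) ha, ?_⟩
    have hf := map_sum (AddMonoidHom.mk' (fun c : EisensteinCoeff p m k ↦
        (EisensteinCoeff.Twisted.tmul c a : EisensteinCoeff.Twisted p m k M))
      (fun c c' ↦ EisensteinCoeff.Twisted.add_tmul c c' a))
      (fun j : Fin m ↦ nn j • EisensteinCoeff.dualFamily p hm k j) Finset.univ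
    refine hf.trans (Finset.sum_congr rfl fun j _ ↦ ?_)
    exact EisensteinCoeff.Twisted.nsmul_tmul' p (nn j) _ a
  | zero =>
    exact ⟨0, fun j ↦ Submodule.zero_mem _, by
      simp only [Pi.zero_apply, EisensteinCoeff.Twisted.tmul_zero, Finset.sum_const_zero]⟩
  | add x y _ _ hx hy =>
    obtain ⟨a, ha, rfl⟩ := hx
    obtain ⟨b, hb, rfl⟩ := hy
    refine ⟨a + b, fun j ↦ Submodule.add_mem _ (ha j) (hb j), ?_⟩
    rw [← Finset.sum_add_distrib]
    exact Finset.sum_congr rfl fun j _ ↦ (EisensteinCoeff.Twisted.tmul_add _ (a j) (b j)).symm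
  | smul n x _ hx =>
    obtain ⟨a, ha, rfl⟩ := hx
    refine ⟨fun j ↦ n • a j, fun j ↦ Submodule.smul_mem _ n (ha j), ?_⟩
    rw [Finset.smul_sum]
    exact Finset.sum_congr rfl fun j _ ↦ (EisensteinCoeff.Twisted.tmul_zsmul _ n (a j)).symm

/-! ## §3 The right `λ_k ∘ E`-orthogonal of `A ⊗ Fil₁` -/

/-- **(hR) Exact right orthogonal, lifted to the twisted spans.**  If every `b ∈ M` with `eb(a, b) = 0` for all `a ∈ Fil₁` lies in
`Fil₂`, then every `t ∈ M ⊗ A_{m,k}` with `λ_k (E(s, t)) = 0` for all `s ∈ A ⊗ Fil₁` lies in `A ⊗ Fil₂` — in coordinates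
`t = ∑ᵢ [T^i] ⊗ wᵢ`, testing against `s = [πⱼ^*] ⊗ a` gives `eb(a, wⱼ) = 0`.  For `M = E[p^k]`, `eb = log e_Weil(·, τ·)`,
`Fil₁ = Fil_v`, `Fil₂ = Fil_v̄` transported, this is Howard's «`Fil_v(T_𝔭)` is its own EXACT orthogonal complement under `e_𝔭`».
[cite: Howard2004HeegnerKolyvagin, Lemma 3.1.1 (arXiv p. 15, L60–62) and Lemma 2.1.1] [cite: DeSmitRubinSchoof1997, Cor. 2.2 (case n = 1)] -/
theorem mem_span_tmul_of_forall_tailFormZMod_eisensteinDualityForm_eq_zero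
    (hR : ∀ b : M, (∀ a ∈ Fil₁, eb a b = 0) → b ∈ Fil₂) (t : EisensteinCoeff.Twisted p m k M)
    (ht : ∀ s ∈ Submodule.span ℤ
        {x | ∃ (c : EisensteinCoeff p m k) (a : M), a ∈ Fil₁ ∧ x = EisensteinCoeff.Twisted.tmul c a},
      EisensteinCoeff.tailFormZMod p hm k (eisensteinDualityForm hm k eb s t) = 0) :
    t ∈ Submodule.span ℤ {x | ∃ (c : EisensteinCoeff p m k) (a : M), a ∈ Fil₂ ∧ x = EisensteinCoeff.Twisted.tmul c a} := by
  have hP : ∀ q : ZMod (p ^ k), (p ^ k) • q = 0 := fun q ↦ by rw [nsmul_eq_mul, ZMod.natCast_self, zero_mul]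
  obtain ⟨w, rfl⟩ := EisensteinCoeff.exists_eq_sum_tmul_mk_X_pow_of_padicInt p hm t
  have hw : ∀ j, w j ∈ Fil₂ := fun j ↦ hR _ fun a ha ↦ by
    have h := ht (EisensteinCoeff.Twisted.tmul (EisensteinCoeff.dualFamily p hm k j) a)
      (Submodule.subset_span ⟨_, a, ha, rfl⟩)
    rwa [tailFormZMod_eisensteinDualityForm, coeffPairing_dualFamily_tmul_sum hm k eb hP j a w] at h
  exact sum_tmul_mem_span_tmul k Fil₂ _ hw

/-! ## §4 Representability on `A ⊗ Fil₁` -/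

/-- **(hS) Representability, lifted to the twisted span.**  If every additive `φ` on `Fil₁` with values in `ℤ/p^k` is `eb(·, b)`
for some `b ∈ M`, then every additive `Φ` on `A ⊗ Fil₁` is `s ↦ λ_k (E(s, t))` for some `t ∈ M ⊗ A_{m,k}`: with `bⱼ` representing
`a ↦ Φ([πⱼ^*] ⊗ a)` take `t = ∑ⱼ [T^j] ⊗ bⱼ` (dual-family coordinates `s = ∑ⱼ [πⱼ^*] ⊗ uⱼ` and `λ_k([πⱼ^*][T^i]) = δᵢⱼ`).  For
`M = E[p^k]` this is the other half of the perfectness of `Fil_v T_𝔭 × Tw(T_𝔭)/Fil′ → S_𝔭(1)`.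
[cite: Howard2004HeegnerKolyvagin, Lemma 2.1.1 and Lemma 3.1.1 (arXiv p. 15, L60–62), §1.3 H.4 («perfect»)]
[cite: DeSmitRubinSchoof1997, Cor. 2.2 (case n = 1)] -/
theorem exists_forall_tailFormZMod_eisensteinDualityForm_eq_of_mem_span_tmul
    (hS : ∀ φ : Fil₁ →+ ZMod (p ^ k), ∃ b : M, ∀ a : Fil₁, eb (a : M) b = φ a)
    (Φ : Submodule.span ℤ
        {x | ∃ (c : EisensteinCoeff p m k) (a : M), a ∈ Fil₁ ∧ x = EisensteinCoeff.Twisted.tmul c a} →+ ZMod (p ^ k)) :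
    ∃ t : EisensteinCoeff.Twisted p m k M, ∀ s (hs : s ∈ Submodule.span ℤ
        {x | ∃ (c : EisensteinCoeff p m k) (a : M), a ∈ Fil₁ ∧ x = EisensteinCoeff.Twisted.tmul c a}),
      EisensteinCoeff.tailFormZMod p hm k (eisensteinDualityForm hm k eb s t) = Φ ⟨s, hs⟩ := by
  have hP : ∀ q : ZMod (p ^ k), (p ^ k) • q = 0 := fun q ↦ by rw [nsmul_eq_mul, ZMod.natCast_self, zero_mul]
  -- the level functionals `φⱼ(a) = Φ([πⱼ^*] ⊗ a)` on `Fil₁` and their representatives `bⱼ`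
  let ψ : Fin m → (Fil₁ →+ ZMod (p ^ k)) := fun j ↦
    { toFun := fun a ↦ Φ ⟨EisensteinCoeff.Twisted.tmul (EisensteinCoeff.dualFamily p hm k j) (a : M),
        Submodule.subset_span ⟨_, (a : M), a.2, rfl⟩⟩
      map_zero' := by
        simp only [ZeroMemClass.coe_zero, EisensteinCoeff.Twisted.tmul_zero]
        exact map_zero Φ
      map_add' := fun a a' ↦ by
        rw [← map_add]
        congr 1
        exact Subtype.ext (by simp only [Submodule.coe_add, EisensteinCoeff.Twisted.tmul_add]) }
  have hψ : ∀ (j : Fin m) (a : Fil₁), ψ j a = Φ ⟨EisensteinCoeff.Twisted.tmul (EisensteinCoeff.dualFamily p hm k j) (a : M),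
      Submodule.subset_span ⟨_, (a : M), a.2, rfl⟩⟩ := fun j a ↦ rfl
  choose b hb using fun j ↦ hS (ψ j)
  refine ⟨∑ i : Fin m, EisensteinCoeff.Twisted.tmul
    (Ideal.Quotient.mk _ ((PowerSeries.X : IwasawaAlgebra p) ^ (i : ℕ)) : EisensteinCoeff p m k) (b i), fun s hs ↦ ?_⟩
  obtain ⟨u, hu, hsu⟩ := exists_eq_sum_tmul_dualFamily_of_mem_span_tmul hm k Fil₁ hs
  subst hsu
  -- `Φ s = ∑ⱼ φⱼ(uⱼ)` by additivity
  have hΦ : Φ ⟨_, hs⟩ = ∑ j : Fin m, ψ j ⟨u j, hu j⟩ := by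
    have hsum : (⟨_, hs⟩ : Submodule.span ℤ
        {x | ∃ (c : EisensteinCoeff p m k) (a : M), a ∈ Fil₁ ∧ x = EisensteinCoeff.Twisted.tmul c a}) =
        ∑ j : Fin m, ⟨EisensteinCoeff.Twisted.tmul (EisensteinCoeff.dualFamily p hm k j) (u j),
          Submodule.subset_span ⟨_, u j, hu j, rfl⟩⟩ :=
      Subtype.ext (by rw [AddSubmonoidClass.coe_finsetSum])
    rw [hsum, map_sum]
    exact Finset.sum_congr rfl fun j _ ↦ rfl
  rw [hΦ, tailFormZMod_eisensteinDualityForm, coeffPairing_sum_tmul_sum hm k eb hP u b]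
  exact Finset.sum_congr rfl fun j _ ↦ hb j ⟨u j, hu j⟩

end ZpExtension

end Literature.NumberTheory.EllipticCurves

end
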